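import Literature.NumberTheory.LFunctions.KloostermanFractionsWeilPair
import Literature.NumberTheory.LFunctions.KloostermanFractionsCoprimeReduction
import Literature.NumberTheory.Sieve.DivisorBound
import HarnessLib

/-!
# Bilinear forms with Kloosterman fractions: the Weil bound (Duke–Friedlander–Iwaniec, Theorems 1 and 5)

Topic `NumberTheory/LFunctions`.  W. Duke, J. Friedlander, H. Iwaniec, *Bilinear forms with
Kloosterman fractions*, Invent. Math. 128 (1997) 23–43, consider
`𝓑(M, N) = ∑∑_{(m,n)=1} α_m β_n e(a m̄/n)` (`m̄ m ≡ 1 (mod n)`, `α_m` on `M < m ≤ 2M`, `β_n` on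
`N < n ≤ 2N`).  Their **Theorem 1** is the bound
`𝓑(M,N) ≪ ‖α‖‖β‖ {(M+N)^{1/2} + (1 + a/MN)^{1/2} min(M,N)} (MN)^ε`, obtained from Cauchy–Schwarz
in `m` and a second-moment estimate (their **Theorem 5**, quoted by Bettin–Chandee, *Trilinear
forms with Kloosterman fractions*, Adv. Math. 328 (2018), §6, as "`𝓒₁ ≪ ‖β‖² A M^{1+ε}` in the
range `M ≫ N²`") which rests only on completion and Weil's bound for Kloosterman sums.  This is
the "unbalanced-range" input of the amplification method proving their Theorem 2 (the named fact
`DukeFriedlanderIwaniec1997_bilinearKloostermanFractions` of `DeterminantEquationDFI.lean` at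
`X = 0`) and of §6 of Bettin–Chandee.  Everything here is PROVED (pair sums:
`KloostermanFractionsWeilPair.lean`; divisor bound: `Sieve/DivisorBound.lean`):

* **`DFI_C_weil_bound`** (Theorem 5, explicit form): for `ε > 0` there is `C` with, for all
  `M ≥ 0`, `N ≥ 1/2`, `k`, and `β` supported on `N < n ≤ 2N`, `(n,k) = 1`,
  `𝓒₁ = ∑_{m ≤ 2M} |∑_{n ≤ 2N,(m,n)=1} β_n e(k m̄/n)|² ≤ C (M + N²) N^ε ‖β‖²`
  (expand; `DFI_pairSum_norm_le` for each pair; `∑_{n₂} (n₁,n₂)²/(n₁n₂) ≤ 2τ(n₁)` for `n₁ > N`;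
  `τ ≤ C N^{ε/4}`, `1 + log ≤ (1 + 4/ε) N^{ε/4}`);
* **`DFI_bilinear_weil_bound_coprime`**, **`DFI_bilinear_weil_bound`** (Theorem 1 in the range
  `M ≥ N`): `|𝓑| ≤ C (M^{1/2} + N) N^ε ‖α‖‖β‖` for `β` coprime to `k`, and
  `≤ C τ(|k|)^{1/2} (M^{1/2} + N) N^ε ‖α‖‖β‖` in general (via the tree's Cauchy–Schwarz
  `DFI_bilinear_le_norm_mul_sqrt_C` and reduction `DFI_bilinear_bound_of_coprime_case`).

What is NOT here: the range `M < N` of Theorem 1 (reciprocity `e(a m̄/n) = e(-a n̄/m) e(a/mn)` and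
the twist, giving the printed factor `(1 + a/MN)^{1/2}`), and Theorem 2 (amplification).  The
statements of Theorems 1, 2 of the source are taken from the review Zbl 0873.11050 (the paper is
not held); the proof is the standard one (expand, CRT, complete, Weil), cf. Bettin–Chandee §3.

## References

* W. Duke, J. Friedlander, H. Iwaniec, Invent. Math. 128 (1997) 23–43, Theorems 1, 5.
  [DukeFriedlanderIwaniec1997]
* S. Bettin, V. Chandee, Adv. Math. 328 (2018) 1234–1262 (arXiv:1502.00769), §6 (use of DFI's
  Theorem 5). [BettinChandee2018]
-/

noncomputable section

open Finset

namespace Literature.NumberTheory.LFunctions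

/-- `‖∑ f‖² = Re ∑∑ f_i conj(f_j)`. [folklore] -/
theorem DFI_norm_sum_sq_eq_re {ι : Type*} (s : Finset ι) (f : ι → ℂ) :
    ‖∑ i ∈ s, f i‖ ^ 2 = (∑ i ∈ s, ∑ j ∈ s, f i * (starRingEnd ℂ) (f j)).re := by
  rw [← Finset.sum_mul_sum, ← map_sum, Complex.mul_conj, Complex.ofReal_re,
    Complex.normSq_eq_norm_sq]

/-- **Duke–Friedlander–Iwaniec, Theorem 5 (the Weil-bound for the second moment), explicit
form.**  For `ε > 0` there is `C = C(ε)` such that for all `M ≥ 0`, `N ≥ 1/2`, `k ∈ ℤ` and all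
`β_n` supported on `N < n ≤ 2N` with `(n, k) = 1`,
`𝓒 = ∑_{m ≤ 2M} |∑_{n ≤ 2N, (m,n)=1} β_n e(k m̄/n)|² ≤ C (M + N²) N^ε ‖β‖²`
(`m̄ m ≡ 1 (mod n)`).  Proof: expand the square; for a pair `(n₁, n₂)` the sum over `m` is an
incomplete Kloosterman sum modulo `[n₁, n₂]` (`DFI_pairSum_norm_le`: completion and Weil's bound),
`≤ 2M (n₁,n₂)²/(n₁n₂) + τ([n₁,n₂]) (n₁n₂)^{1/2}(1 + log[n₁,n₂])`; the gcd sum is `≤ 2τ(n₁)` on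
average over `n₂` (`DFI_sum_gcd_le`) and `τ ≪ N^{ε/4}`.  This is the estimate quoted as
"Theorem 5 of [DFI97]: `𝓒₁ ≪ ‖β‖² M^{1+ε}` for `M ≫ N²`" in Bettin–Chandee §6, and the input of
Theorem 1 of Duke–Friedlander–Iwaniec (`𝓑 ≪ ‖α‖‖β‖(M^{1/2} + N)(MN)^ε` for `M ≥ N`).
[cite: DukeFriedlanderIwaniec1997, Theorem 5 and Theorem 1] -/
theorem DFI_C_weil_bound {ε : ℝ} (hε : 0 < ε) :
    ∃ C : ℝ, 0 < C ∧ ∀ (M N : ℝ), 0 ≤ M → 1 / 2 ≤ N → ∀ (k : ℤ) (β : ℕ → ℂ),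
      (∀ n : ℕ, β n ≠ 0 → N < n ∧ (n : ℝ) ≤ 2 * N) →
      (∀ n : ℕ, β n ≠ 0 → n.Coprime k.natAbs) →
      ∑ m ∈ Icc 1 ⌊2 * M⌋₊, ‖∑ n ∈ Icc 1 ⌊2 * N⌋₊,
          if m.Coprime n then
            β n * Complex.exp (2 * Real.pi * Complex.I *
              ((k : ℂ) * ((((m : ZMod n)⁻¹).val : ℕ) : ℂ) / (n : ℂ)))
          else 0‖ ^ 2 ≤
        C * (M + N ^ 2) * N ^ ε * ∑ n ∈ Icc 1 ⌊2 * N⌋₊, ‖β n‖ ^ 2 := by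
  obtain ⟨C₁, hC₁1, hC₁⟩ :=
    Literature.NumberTheory.Sieve.exists_card_divisors_le_mul_rpow (ε := ε / 4) (by positivity)
  set δ : ℝ := ε / 4 with hδ
  have hδ0 : 0 < δ := by positivity
  have hC₁0 : 0 < C₁ := by linarith
  refine ⟨8 * C₁ * (1 + 1 / δ) * 2 ^ ε, by positivity, ?_⟩
  intro M N hM hN k β hβ hβk
  have hN0 : 0 < N := by linarith
  have h2N1 : (1 : ℝ) ≤ 2 * N := by linarith
  set S := Icc 1 ⌊2 * N⌋₊ with hS
  set A : ℕ := ⌊2 * M⌋₊ with hA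
  have hA2M : (A : ℝ) ≤ 2 * M := Nat.floor_le (by positivity)
  have hX2N : ((⌊2 * N⌋₊ : ℕ) : ℝ) ≤ 2 * N := Nat.floor_le (by positivity)
  set P : ℝ := (2 * N) ^ δ with hP
  have hP1 : 1 ≤ P := Real.one_le_rpow h2N1 hδ0.le
  have hP0 : 0 < P := by linarith
  set nβ : ℝ := ∑ n ∈ S, ‖β n‖ ^ 2 with hnβ
  have hnβ0 : 0 ≤ nβ := Finset.sum_nonneg fun _ _ => sq_nonneg _
  -- facts about the support
  have hmemS : ∀ {n : ℕ}, n ∈ S → 0 < n := fun hn => (Finset.mem_Icc.mp hn).1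
  have hleS : ∀ {n : ℕ}, n ∈ S → (n : ℝ) ≤ 2 * N := fun hn =>
    le_trans (by exact_mod_cast (Finset.mem_Icc.mp hn).2) hX2N
  -- the summand and the pair sums
  set F : ℕ → ℕ → ℂ := fun m n => if m.Coprime n then β n * kfPhase k n m else 0 with hF
  set T : ℕ → ℕ → ℂ := fun n₁ n₂ => ∑ m ∈ Icc 1 A,
    (if m.Coprime n₁ ∧ m.Coprime n₂ then kfPhase k n₁ m * (starRingEnd ℂ) (kfPhase k n₂ m) else 0)
    with hT
  set w : ℕ → ℕ → ℝ := fun n₁ n₂ => (A : ℝ) * (n₁.gcd n₂ : ℝ) ^ 2 / ((n₁ : ℝ) * n₂) with hw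
  set E : ℝ := 4 * C₁ * (1 + 1 / δ) * N * P ^ 3 with hE
  have hE0 : 0 ≤ E := by positivity
  change ∑ m ∈ Icc 1 A, ‖∑ n ∈ S, F m n‖ ^ 2 ≤ 8 * C₁ * (1 + 1 / δ) * 2 ^ ε * (M + N ^ 2) * N ^ ε * nβ
  -- Step 1: expand the square and exchange the sums
  have hFF : ∀ m n₁ n₂, F m n₁ * (starRingEnd ℂ) (F m n₂) =
      β n₁ * (starRingEnd ℂ) (β n₂) *
        (if m.Coprime n₁ ∧ m.Coprime n₂ then
          kfPhase k n₁ m * (starRingEnd ℂ) (kfPhase k n₂ m) else 0) := by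
    intro m n₁ n₂
    show (if m.Coprime n₁ then β n₁ * kfPhase k n₁ m else 0) *
        (starRingEnd ℂ) (if m.Coprime n₂ then β n₂ * kfPhase k n₂ m else 0) = _
    by_cases h₁ : m.Coprime n₁
    · by_cases h₂ : m.Coprime n₂
      · rw [if_pos h₁, if_pos h₂, if_pos ⟨h₁, h₂⟩, map_mul]; ring
      · rw [if_pos h₁, if_neg h₂,
          if_neg (show ¬(m.Coprime n₁ ∧ m.Coprime n₂) from fun h => h₂ h.2),
          map_zero, mul_zero, mul_zero]
    · rw [if_neg h₁, if_neg (show ¬(m.Coprime n₁ ∧ m.Coprime n₂) from fun h => h₁ h.1),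
        zero_mul, mul_zero]
  have hstep1 : ∑ m ∈ Icc 1 A, ‖∑ n ∈ S, F m n‖ ^ 2 ≤
      ∑ n₁ ∈ S, ∑ n₂ ∈ S, ‖β n₁‖ * ‖β n₂‖ * ‖T n₁ n₂‖ := by
    have h1 : ∑ m ∈ Icc 1 A, ‖∑ n ∈ S, F m n‖ ^ 2 =
        (∑ n₁ ∈ S, ∑ n₂ ∈ S, β n₁ * (starRingEnd ℂ) (β n₂) * T n₁ n₂).re := by
      simp_rw [DFI_norm_sum_sq_eq_re]
      rw [← Complex.re_sum, Finset.sum_comm]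
      congr 1
      refine Finset.sum_congr rfl fun n₁ _ => ?_
      rw [Finset.sum_comm]
      refine Finset.sum_congr rfl fun n₂ _ => ?_
      rw [hT, Finset.mul_sum]
      exact Finset.sum_congr rfl fun m _ => hFF m n₁ n₂
    rw [h1]
    refine (Complex.re_le_norm _).trans ((norm_sum_le _ _).trans (Finset.sum_le_sum fun n₁ _ =>
      (norm_sum_le _ _).trans (Finset.sum_le_sum fun n₂ _ => le_of_eq ?_)))
    rw [norm_mul, norm_mul, Complex.norm_conj]
  -- Step 2: the bound for one pair
  have hpair : ∀ n₁ ∈ S, ∀ n₂ ∈ S,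
      ‖β n₁‖ * ‖β n₂‖ * ‖T n₁ n₂‖ ≤ ‖β n₁‖ * ‖β n₂‖ * (w n₁ n₂ + E) := by
    intro n₁ hn₁ n₂ hn₂
    by_cases hb₁ : β n₁ = 0
    · simp [hb₁]
    by_cases hb₂ : β n₂ = 0
    · simp [hb₂]
    have hn₁0 := hmemS hn₁
    have hn₂0 := hmemS hn₂
    have hn₁r : (0 : ℝ) < n₁ := by exact_mod_cast hn₁0
    have hn₂r : (0 : ℝ) < n₂ := by exact_mod_cast hn₂0
    have h12 : (n₁ : ℝ) * n₂ ≤ (2 * N) ^ 2 := by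
      have := hleS hn₁; have := hleS hn₂
      nlinarith
    gcongr
    refine (DFI_pairSum_norm_le k hn₁0 hn₂0 (hβk n₁ hb₁) (hβk n₂ hb₂) A).trans ?_
    change w n₁ n₂ + _ ≤ w n₁ n₂ + E
    gcongr
    -- `τ(Q) √(n₁n₂) (1 + log Q) ≤ E`
    have hQ0 : 0 < n₁.lcm n₂ := Nat.lcm_pos hn₁0 hn₂0
    have hQle : ((n₁.lcm n₂ : ℕ) : ℝ) ≤ (2 * N) ^ 2 := by
      have h := Nat.lcm_dvd_mul n₁ n₂
      have h' : ((n₁.lcm n₂ : ℕ) : ℝ) ≤ (n₁ : ℝ) * n₂ := by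
        exact_mod_cast Nat.le_of_dvd (Nat.mul_pos hn₁0 hn₂0) h
      exact h'.trans h12
    have hQ1 : (1 : ℝ) ≤ (n₁.lcm n₂ : ℕ) := by exact_mod_cast hQ0
    have hτ : ((n₁.lcm n₂).divisors.card : ℝ) ≤ C₁ * P ^ 2 := by
      refine (hC₁ _ hQ0.ne').trans ?_
      have hP2 : ((2 * N) ^ 2) ^ δ = P ^ 2 := by
        rw [hP, ← Real.rpow_natCast ((2 * N) ^ δ), ← Real.rpow_mul (by positivity),
          mul_comm δ, Real.rpow_mul (by positivity), Real.rpow_natCast]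
      rw [← hP2]
      gcongr
    have hsq : Real.sqrt ((n₁ : ℝ) * n₂) ≤ 2 * N := by
      rw [← Real.sqrt_sq (by positivity : (0 : ℝ) ≤ 2 * N)]
      exact Real.sqrt_le_sqrt h12
    have hlg : 1 + Real.log (n₁.lcm n₂ : ℕ) ≤ 2 * ((1 + 1 / δ) * P) := by
      have h1 : Real.log (n₁.lcm n₂ : ℕ) ≤ Real.log ((2 * N) ^ 2) := Real.log_le_log (by positivity) hQle
      rw [Real.log_pow] at h1
      -- `1 + log(2N) ≤ (1 + 1/δ)(2N)^δ` (as `log u ≤ u^δ/δ`, `1 ≤ u^δ`)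
      have h2 : 1 + Real.log (2 * N) ≤ (1 + 1 / δ) * (2 * N) ^ δ := by
        have h3 : Real.log (2 * N) ≤ (2 * N) ^ δ / δ := Real.log_le_rpow_div (by positivity) hδ0
        have h4 : (1 : ℝ) ≤ (2 * N) ^ δ := Real.one_le_rpow h2N1 hδ0.le
        calc 1 + Real.log (2 * N) ≤ (2 * N) ^ δ + (2 * N) ^ δ / δ := add_le_add h4 h3
          _ = (1 + 1 / δ) * (2 * N) ^ δ := by ring
      push_cast at h1
      linarith
    have hlg0 : 0 ≤ 1 + Real.log (n₁.lcm n₂ : ℕ) := by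
      have := Real.log_nonneg hQ1; linarith
    calc ((n₁.lcm n₂).divisors.card : ℝ) * Real.sqrt ((n₁ : ℝ) * n₂) * (1 + Real.log (n₁.lcm n₂ : ℕ))
        ≤ (C₁ * P ^ 2) * (2 * N) * (2 * ((1 + 1 / δ) * P)) := by gcongr
      _ = E := by rw [hE]; ring
  -- Step 3: the gcd term
  have hwsum : ∀ n₁ ∈ S, ‖β n₁‖ ^ 2 * ∑ n₂ ∈ S, w n₁ n₂ ≤ ‖β n₁‖ ^ 2 * (4 * C₁ * M * P) := by
    intro n₁ hn₁
    by_cases hb₁ : β n₁ = 0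
    · simp [hb₁]
    have hn₁0 := hmemS hn₁
    have hn₁r : (0 : ℝ) < n₁ := by exact_mod_cast hn₁0
    have hNn₁ : N < n₁ := (hβ n₁ hb₁).1
    gcongr
    -- `∑_{n₂} A g²/(n₁n₂) ≤ (A/n₁) ∑ g ≤ (A/n₁) X τ(n₁) ≤ 4 C₁ M P`
    have h1 : ∀ n₂ ∈ S, w n₁ n₂ ≤ (A : ℝ) / n₁ * (n₁.gcd n₂ : ℝ) := by
      intro n₂ hn₂
      have hn₂0 := hmemS hn₂
      have hn₂r : (0 : ℝ) < n₂ := by exact_mod_cast hn₂0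
      have hg : (n₁.gcd n₂ : ℝ) ≤ n₂ := by exact_mod_cast Nat.gcd_le_right _ hn₂0
      rw [hw]
      simp only
      rw [div_mul_eq_mul_div, div_le_div_iff₀ (by positivity) hn₁r]
      have hg0 : (0 : ℝ) ≤ n₁.gcd n₂ := Nat.cast_nonneg _
      have hA0 : (0 : ℝ) ≤ A := Nat.cast_nonneg _
      calc (A : ℝ) * (n₁.gcd n₂ : ℝ) ^ 2 * n₁ = (A * n₁.gcd n₂ * n₁) * n₁.gcd n₂ := by ring
        _ ≤ (A * n₁.gcd n₂ * n₁) * n₂ := by gcongr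
        _ = A * n₁.gcd n₂ * (n₁ * n₂) := by ring
    have h2 := DFI_sum_gcd_le ⌊2 * N⌋₊ hn₁0
    have h3 : ((n₁.divisors.card : ℕ) : ℝ) ≤ C₁ * P := by
      refine (hC₁ n₁ hn₁0.ne').trans ?_
      rw [hP]
      gcongr
      exact hleS hn₁
    calc ∑ n₂ ∈ S, w n₁ n₂ ≤ ∑ n₂ ∈ S, (A : ℝ) / n₁ * (n₁.gcd n₂ : ℝ) := Finset.sum_le_sum h1
      _ = (A : ℝ) / n₁ * ∑ n₂ ∈ S, (n₁.gcd n₂ : ℝ) := by rw [Finset.mul_sum]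
      _ ≤ (A : ℝ) / n₁ * (⌊2 * N⌋₊ * (n₁.divisors.card : ℝ)) := by gcongr
      _ ≤ (2 * M) / n₁ * ((2 * N) * (C₁ * P)) := by gcongr
      _ = 4 * C₁ * M * P * (N / n₁) := by ring
      _ ≤ 4 * C₁ * M * P * 1 := by
          gcongr
          rw [div_le_one hn₁r]
          exact hNn₁.le
      _ = 4 * C₁ * M * P := mul_one _
  have hstep3 : ∑ n₁ ∈ S, ∑ n₂ ∈ S, ‖β n₁‖ * ‖β n₂‖ * w n₁ n₂ ≤ 4 * C₁ * M * P * nβ := by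
    have hsymm : ∀ n₁ n₂, w n₁ n₂ = w n₂ n₁ := by
      intro n₁ n₂; simp only [hw, Nat.gcd_comm, mul_comm]
    have hw0 : ∀ n₁ n₂, 0 ≤ w n₁ n₂ := fun n₁ n₂ => by positivity
    have h1 : ∑ n₁ ∈ S, ∑ n₂ ∈ S, ‖β n₁‖ * ‖β n₂‖ * w n₁ n₂ ≤
        ∑ n₁ ∈ S, ∑ n₂ ∈ S, (‖β n₁‖ ^ 2 * w n₁ n₂ / 2 + ‖β n₂‖ ^ 2 * w n₁ n₂ / 2) := by
      refine Finset.sum_le_sum fun n₁ _ => Finset.sum_le_sum fun n₂ _ => ?_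
      have := hw0 n₁ n₂
      nlinarith [sq_nonneg (‖β n₁‖ - ‖β n₂‖)]
    have h2 : ∑ n₁ ∈ S, ∑ n₂ ∈ S, ‖β n₂‖ ^ 2 * w n₁ n₂ / 2 =
        ∑ n₁ ∈ S, ∑ n₂ ∈ S, ‖β n₁‖ ^ 2 * w n₁ n₂ / 2 := by
      rw [Finset.sum_comm]
      refine Finset.sum_congr rfl fun n₁ _ => Finset.sum_congr rfl fun n₂ _ => ?_
      rw [hsymm]
    calc ∑ n₁ ∈ S, ∑ n₂ ∈ S, ‖β n₁‖ * ‖β n₂‖ * w n₁ n₂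
        ≤ ∑ n₁ ∈ S, ∑ n₂ ∈ S, (‖β n₁‖ ^ 2 * w n₁ n₂ / 2 + ‖β n₂‖ ^ 2 * w n₁ n₂ / 2) := h1
      _ = ∑ n₁ ∈ S, ∑ n₂ ∈ S, ‖β n₁‖ ^ 2 * w n₁ n₂ := by
          simp_rw [Finset.sum_add_distrib]
          rw [h2, ← Finset.sum_add_distrib]
          refine Finset.sum_congr rfl fun n₁ _ => ?_
          rw [← Finset.sum_add_distrib]
          refine Finset.sum_congr rfl fun n₂ _ => ?_
          ring
      _ = ∑ n₁ ∈ S, ‖β n₁‖ ^ 2 * ∑ n₂ ∈ S, w n₁ n₂ := by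
          refine Finset.sum_congr rfl fun n₁ _ => ?_
          rw [Finset.mul_sum]
      _ ≤ ∑ n₁ ∈ S, ‖β n₁‖ ^ 2 * (4 * C₁ * M * P) := Finset.sum_le_sum hwsum
      _ = 4 * C₁ * M * P * nβ := by rw [← Finset.sum_mul]; ring
  -- Step 4: the constant term, by Cauchy–Schwarz
  have hstep4 : ∑ n₁ ∈ S, ∑ n₂ ∈ S, ‖β n₁‖ * ‖β n₂‖ * E ≤ E * (2 * N) * nβ := by
    have h1 : ∑ n₁ ∈ S, ∑ n₂ ∈ S, ‖β n₁‖ * ‖β n₂‖ * E = E * (∑ n ∈ S, ‖β n‖) ^ 2 := by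
      rw [sq, Finset.sum_mul_sum, Finset.mul_sum]
      refine Finset.sum_congr rfl fun n₁ _ => ?_
      rw [Finset.mul_sum]
      refine Finset.sum_congr rfl fun n₂ _ => ?_
      ring
    have hcs : (∑ n ∈ S, ‖β n‖) ^ 2 ≤ 2 * N * nβ := by
      calc (∑ n ∈ S, ‖β n‖) ^ 2 ≤ S.card * ∑ n ∈ S, ‖β n‖ ^ 2 := sq_sum_le_card_mul_sum_sq
        _ ≤ (2 * N) * nβ := by
            have hcard : (S.card : ℝ) ≤ 2 * N := by
              rw [hS, Nat.card_Icc]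
              simpa using hX2N
            exact mul_le_mul_of_nonneg_right hcard hnβ0
    rw [h1]
    calc E * (∑ n ∈ S, ‖β n‖) ^ 2 ≤ E * (2 * N * nβ) := mul_le_mul_of_nonneg_left hcs hE0
      _ = E * (2 * N) * nβ := by ring
  -- assembling
  have hP3 : P ^ 3 ≤ 2 ^ ε * N ^ ε := by
    have h1 : P ^ 3 = (2 : ℝ) ^ (3 * δ) * (N ^ ε * N ^ (-δ)) := by
      rw [hP, ← Real.rpow_natCast ((2 * N) ^ δ), ← Real.rpow_mul (by positivity),
        Real.mul_rpow (by norm_num) hN0.le, ← Real.rpow_add hN0]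
      congr 1
      · norm_num; ring
      · congr 1; rw [hδ]; push_cast; ring
    have h2 : N ^ (-δ) ≤ (2 : ℝ) ^ δ := by
      calc N ^ (-δ) ≤ (1 / 2 : ℝ) ^ (-δ) :=
            Real.rpow_le_rpow_of_nonpos (by norm_num) hN (by linarith)
        _ = 2 ^ δ := by rw [Real.div_rpow zero_le_one (by norm_num), Real.one_rpow,
            Real.rpow_neg (by norm_num), one_div, inv_inv]
    have h3 : (2 : ℝ) ^ (3 * δ) * 2 ^ δ = 2 ^ ε := by
      rw [← Real.rpow_add (by norm_num)]; congr 1; rw [hδ]; ring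
    calc P ^ 3 = (2 : ℝ) ^ (3 * δ) * (N ^ ε * N ^ (-δ)) := h1
      _ ≤ (2 : ℝ) ^ (3 * δ) * (N ^ ε * 2 ^ δ) := by gcongr
      _ = 2 ^ ε * N ^ ε := by rw [← h3]; ring
  have hPP3 : P ≤ P ^ 3 := by
    calc P = P ^ 1 := (pow_one P).symm
      _ ≤ P ^ 3 := pow_le_pow_right₀ hP1 (by norm_num)
  calc ∑ m ∈ Icc 1 A, ‖∑ n ∈ S, F m n‖ ^ 2
      ≤ ∑ n₁ ∈ S, ∑ n₂ ∈ S, ‖β n₁‖ * ‖β n₂‖ * ‖T n₁ n₂‖ := hstep1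
    _ ≤ ∑ n₁ ∈ S, ∑ n₂ ∈ S, ‖β n₁‖ * ‖β n₂‖ * (w n₁ n₂ + E) :=
        Finset.sum_le_sum fun n₁ hn₁ => Finset.sum_le_sum fun n₂ hn₂ => hpair n₁ hn₁ n₂ hn₂
    _ = ∑ n₁ ∈ S, ∑ n₂ ∈ S, ‖β n₁‖ * ‖β n₂‖ * w n₁ n₂ +
          ∑ n₁ ∈ S, ∑ n₂ ∈ S, ‖β n₁‖ * ‖β n₂‖ * E := by
        rw [← Finset.sum_add_distrib]
        refine Finset.sum_congr rfl fun n₁ _ => ?_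
        rw [← Finset.sum_add_distrib]
        refine Finset.sum_congr rfl fun n₂ _ => ?_
        ring
    _ ≤ 4 * C₁ * M * P * nβ + E * (2 * N) * nβ := add_le_add hstep3 hstep4
    _ = (4 * C₁ * M * P + 8 * C₁ * (1 + 1 / δ) * N ^ 2 * P ^ 3) * nβ := by rw [hE]; ring
    _ ≤ (8 * C₁ * (1 + 1 / δ) * M * P ^ 3 + 8 * C₁ * (1 + 1 / δ) * N ^ 2 * P ^ 3) * nβ := by
        refine mul_le_mul_of_nonneg_right (add_le_add ?_ le_rfl) hnβ0
        have h0 : 0 ≤ C₁ * M * P ^ 3 := by positivity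
        have h1 : (0 : ℝ) ≤ 1 / δ := by positivity
        calc 4 * C₁ * M * P ≤ 4 * C₁ * M * P ^ 3 := by gcongr
          _ ≤ 8 * C₁ * (1 + 1 / δ) * M * P ^ 3 := by nlinarith [mul_nonneg h0 h1]
    _ = 8 * C₁ * (1 + 1 / δ) * (M + N ^ 2) * P ^ 3 * nβ := by ring
    _ ≤ 8 * C₁ * (1 + 1 / δ) * (M + N ^ 2) * (2 ^ ε * N ^ ε) * nβ := by gcongr
    _ = 8 * C₁ * (1 + 1 / δ) * 2 ^ ε * (M + N ^ 2) * N ^ ε * nβ := by ring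

/-- **Duke–Friedlander–Iwaniec, Theorem 1 (the range `M ≥ N`), coprime coefficients.**  For
`ε > 0` there is `C = C(ε)` with: for all `M, N ≥ 1/2`, `k ∈ ℤ`, all `α_m` and all `β_n` supported
on `N < n ≤ 2N`, `(n, k) = 1`,
`|∑∑_{(m,n)=1} α_m β_n e(k m̄/n)| ≤ C (M^{1/2} + N) N^ε ‖α‖ ‖β‖`
(Cauchy–Schwarz in `m` and `DFI_C_weil_bound`; the printed Theorem 1 is
`≪ ‖α‖‖β‖{(M+N)^{1/2} + (1 + a/MN)^{1/2} min(M,N)}(MN)^ε`, of which this is the case `M ≥ N`,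
where no dependence on `a = k` arises once `(n, k) = 1`).
[cite: DukeFriedlanderIwaniec1997, Theorem 1] -/
theorem DFI_bilinear_weil_bound_coprime {ε : ℝ} (hε : 0 < ε) :
    ∃ C : ℝ, 0 < C ∧ ∀ (M N : ℝ), 1 / 2 ≤ M → 1 / 2 ≤ N → ∀ (k : ℤ) (α β : ℕ → ℂ),
      (∀ n : ℕ, β n ≠ 0 → N < n ∧ (n : ℝ) ≤ 2 * N) →
      (∀ n : ℕ, β n ≠ 0 → n.Coprime k.natAbs) →
      ‖∑ m ∈ Icc 1 ⌊2 * M⌋₊, ∑ n ∈ Icc 1 ⌊2 * N⌋₊,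
          if m.Coprime n then
            α m * β n * Complex.exp (2 * Real.pi * Complex.I *
              ((k : ℂ) * ((((m : ZMod n)⁻¹).val : ℕ) : ℂ) / (n : ℂ)))
          else 0‖ ≤
        C * (Real.sqrt M + N) * N ^ ε * Real.sqrt (∑ m ∈ Icc 1 ⌊2 * M⌋₊, ‖α m‖ ^ 2) *
          Real.sqrt (∑ n ∈ Icc 1 ⌊2 * N⌋₊, ‖β n‖ ^ 2) := by
  obtain ⟨C₀, hC₀, hC⟩ := DFI_C_weil_bound (ε := 2 * ε) (by positivity)
  refine ⟨Real.sqrt C₀, Real.sqrt_pos.mpr hC₀, ?_⟩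
  intro M N hM hN k α β hβ hβk
  have hM0 : 0 ≤ M := by linarith
  have hN0 : 0 < N := by linarith
  have h1 := DFI_bilinear_le_norm_mul_sqrt_C M N k α β
  have h2 := hC M N hM0 hN k β hβ hβk
  set nα := Real.sqrt (∑ m ∈ Icc 1 ⌊2 * M⌋₊, ‖α m‖ ^ 2) with hnα
  set nβ2 := ∑ n ∈ Icc 1 ⌊2 * N⌋₊, ‖β n‖ ^ 2 with hnβ2
  have hnβ0 : 0 ≤ nβ2 := Finset.sum_nonneg fun _ _ => sq_nonneg _
  refine h1.trans ?_
  have h3 : Real.sqrt (∑ m ∈ Icc 1 ⌊2 * M⌋₊, ‖∑ n ∈ Icc 1 ⌊2 * N⌋₊,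
      if m.Coprime n then
        β n * Complex.exp (2 * Real.pi * Complex.I *
          ((k : ℂ) * ((((m : ZMod n)⁻¹).val : ℕ) : ℂ) / (n : ℂ)))
      else 0‖ ^ 2) ≤ Real.sqrt C₀ * (Real.sqrt M + N) * N ^ ε * Real.sqrt nβ2 := by
    refine (Real.sqrt_le_sqrt h2).trans ?_
    rw [Real.sqrt_mul' _ hnβ0, Real.sqrt_mul (by positivity), Real.sqrt_mul hC₀.le]
    gcongr
    · -- `√(M + N²) ≤ √M + N`
      rw [Real.sqrt_le_left (by positivity)]
      nlinarith [Real.sq_sqrt hM0, Real.sqrt_nonneg M]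
    · rw [show (2 * ε) = ε * 2 by ring, Real.rpow_mul hN0.le, Real.sqrt_eq_rpow, ← Real.rpow_mul
        (by positivity)]
      norm_num
  calc nα * _ ≤ nα * (Real.sqrt C₀ * (Real.sqrt M + N) * N ^ ε * Real.sqrt nβ2) := by gcongr
    _ = Real.sqrt C₀ * (Real.sqrt M + N) * N ^ ε * nα * Real.sqrt nβ2 := by ring

/-- **Duke–Friedlander–Iwaniec, Theorem 1 (the range `M ≥ N`), general coefficients.**  For
`ε > 0` there is `C = C(ε)` with: for all `M, N ≥ 1/2`, `k ≠ 0`, and all `α_m` (`M < m ≤ 2M`),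
`β_n` (`N < n ≤ 2N`),
`|∑∑_{(m,n)=1} α_m β_n e(k m̄/n)| ≤ C τ(|k|)^{1/2} (M^{1/2} + N) N^ε ‖α‖ ‖β‖`
(the coprime case and the reduction `DFI_bilinear_bound_of_coprime_case` of the tree; compare the
printed `≪ ‖α‖‖β‖{(M+N)^{1/2} + (1 + a/MN)^{1/2} min(M,N)}(MN)^ε`).
[cite: DukeFriedlanderIwaniec1997, Theorem 1] -/
theorem DFI_bilinear_weil_bound {ε : ℝ} (hε : 0 < ε) :
    ∃ C : ℝ, 0 < C ∧ ∀ (M N : ℝ), 1 / 2 ≤ M → 1 / 2 ≤ N → ∀ (k : ℤ), k ≠ 0 → ∀ (α β : ℕ → ℂ),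
      (∀ m : ℕ, α m ≠ 0 → M < m ∧ (m : ℝ) ≤ 2 * M) →
      (∀ n : ℕ, β n ≠ 0 → N < n ∧ (n : ℝ) ≤ 2 * N) →
      ‖∑ m ∈ Icc 1 ⌊2 * M⌋₊, ∑ n ∈ Icc 1 ⌊2 * N⌋₊,
          if m.Coprime n then
            α m * β n * Complex.exp (2 * Real.pi * Complex.I *
              ((k : ℂ) * ((((m : ZMod n)⁻¹).val : ℕ) : ℂ) / (n : ℂ)))
          else 0‖ ≤
        C * Real.sqrt (k.natAbs.divisors.card) * (Real.sqrt M + N) * N ^ ε *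
          Real.sqrt (∑ m ∈ Icc 1 ⌊2 * M⌋₊, ‖α m‖ ^ 2) *
          Real.sqrt (∑ n ∈ Icc 1 ⌊2 * N⌋₊, ‖β n‖ ^ 2) := by
  obtain ⟨C, hC0, hC⟩ := DFI_bilinear_weil_bound_coprime hε
  refine ⟨C, hC0, ?_⟩
  intro M N hM hN k hk α β hα hβ
  -- the bound `G(M, N, k) = C (√M + N*) N*^ε`, `N* = max N (1/2)`, is monotone in `N`
  set G : ℝ → ℝ → ℤ → ℝ := fun M' N' _ =>
    C * (Real.sqrt M' + max N' (1 / 2)) * (max N' (1 / 2)) ^ ε with hG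
  have hG0 : ∀ M' N' k', 0 ≤ G M' N' k' := by
    intro M' N' k'
    simp only [hG]
    have : (0 : ℝ) < max N' (1 / 2) := lt_max_of_lt_right (by norm_num)
    positivity
  have hGmono : ∀ (M' N' : ℝ) (k' : ℤ) (d : ℕ), 0 < d → (d : ℤ) ∣ k' →
      G M' (N' / d) (k' / d) ≤ G M' N' k' := by
    intro M' N' k' d hd _
    simp only [hG]
    have hd1 : (1 : ℝ) ≤ d := by exact_mod_cast hd
    have hmax : max (N' / d) (1 / 2) ≤ max N' (1 / 2) := by
      rcases le_or_gt 0 N' with h | h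
      · exact max_le_max (div_le_self h hd1) le_rfl
      · have : N' / d < 1 / 2 := by
          have : N' / d ≤ 0 := div_nonpos_of_nonpos_of_nonneg h.le (by positivity)
          linarith
        rw [max_eq_right this.le]
        exact le_max_right _ _
    have h0 : (0 : ℝ) < max (N' / d) (1 / 2) := lt_max_of_lt_right (by norm_num)
    gcongr
  have hcore : ∀ (M' N' : ℝ), 1 / 2 ≤ M' → 1 / 2 ≤ N' → ∀ (k' : ℤ), k' ≠ 0 → ∀ (α' β' : ℕ → ℂ),
      (∀ m : ℕ, α' m ≠ 0 → M' < m ∧ (m : ℝ) ≤ 2 * M') →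
      (∀ n : ℕ, β' n ≠ 0 → N' < n ∧ (n : ℝ) ≤ 2 * N') →
      (∀ n : ℕ, β' n ≠ 0 → n.Coprime k'.natAbs) →
      ‖∑ m ∈ Icc 1 ⌊2 * M'⌋₊, ∑ n ∈ Icc 1 ⌊2 * N'⌋₊,
          if m.Coprime n then
            α' m * β' n * Complex.exp (2 * Real.pi * Complex.I *
              ((k' : ℂ) * ((((m : ZMod n)⁻¹).val : ℕ) : ℂ) / (n : ℂ)))
          else 0‖ ≤
        Real.sqrt (∑ m ∈ Icc 1 ⌊2 * M'⌋₊, ‖α' m‖ ^ 2) *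
          Real.sqrt (∑ n ∈ Icc 1 ⌊2 * N'⌋₊, ‖β' n‖ ^ 2) * G M' N' k' := by
    intro M' N' hM' hN' k' _ α' β' _ hβ' hβ'k
    have h := hC M' N' hM' hN' k' α' β' hβ' hβ'k
    simp only [hG, max_eq_left hN']
    linarith [h]
  have h := DFI_bilinear_bound_of_coprime_case G hG0 hGmono hcore M N hM hN k hk α β hα hβ
  simp only [hG, max_eq_left hN] at h
  linarith [h]

end Literature.NumberTheory.LFunctions

end
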